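import Summits.QuantumFields.YangMills.Theorems.LuscherReductionDressedRitzLiftLeakageFirstMoment
import Summits.QuantumFields.YangMills.Theorems.LuscherReductionDressedRitzLiftLeakageEuclidean
import Summits.QuantumFields.YangMills.Theorems.LuscherReductionDressedRitzPolyakovLiftBasisGeneric
import HarnessLib

/-!
# Crux `DressedRitz` (stmt-QuantumFields-20205), line «polyakovlift», stub S-LEAK `stub_liftLeakage` — support XXII:
# the S-LEAK closing package PARAMETRIC IN THE ONE-SITE BASIS PREDICATE (r6-ready)

Support module (fleet seat ym-20205-polyakovlift-s1 gen 2; `--supports stmt-QuantumFields-20205`, helper, no closure claim).  Skeleton r5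
(sha16 8b6782afbcc2a19a, of record) keys S-LEAK to the one-site eigen-ratio bases `LiftBasis (2/Λ³) k ω g`; the lead's candidate reshape r6
(«explicit transplanted observables», `R6-DESIGN.md`) re-keys every stub to the basis-PARAMETRIC texts of `…PolyakovLiftBasisGeneric.lean`
(p551613): S-LEAK becomes `∀ k, LeakageFor (P k)` at `P := TransplantBasis` (p551813; or its repair after the disprover's pre-vet V1).  The closing
press-buttons of supports XV–XXI (`liftLeakage_of_statics_and_core`, `…_firstMomentCore`, `…_statics_universality_core`) are r5-keyed: they reduce
the `∀ LiftBasis` quantifier to ONE reference one-site eigenfamily at `B₁`, using that lift-basis members are EXACT one-site eigenfunctions.  For an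
arbitrary basis predicate no such reduction exists (nor is one needed): the per-lattice-point press-button XIV
`leakageClause_dressed_of_slow_outside` is basis-agnostic, so the located renormalisation-group core can simply be asked PER BASIS MEMBER.  This file:

* §1 `leakageFor_of_imp` — `LeakageFor` is ANTITONE in the predicate (a radius pin / any restriction of the basis class is free);
  `leakageFor_liftBasisPred_iff` — at `P := liftBasisPred k` the text is the level-`k` r5 text, and ★ `forall_leakageFor_liftBasisPred_iff` —
  `(∀ k, LeakageFor (liftBasisPred k)) ↔` the registered r5 text of `Stmt.stub_liftLeakage` VERBATIM;
* §2 `leakageFor_of_residualLaw` — `LeakageFor P` from a per-member dressed residual law at the Perron–Frobenius vacuum package (IX generic);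
* §3 `SlowOutsideCoreFor P` — per `P`-basis member `g_i`, per lattice point, at the PF package `(Ω, θ, c)`: ONE exact fine eigenfamily `χ` (levels `μ`,
  domination `Λ`), an own index `j₀`, a slow set `S`, and on the UNDRESSED insertion state `x_i = liftVec β Ω g_i`
  (SLOW) `Σ_{j∈S}(μ_j − μ_{j₀})²μ_j^{2L}⟨x_i,χ_j⟩² ≤ C₁(λ³/L²)λ₀²μ_{j₀}^{2L}⟨x_i,χ_{j₀}⟩²`, (OUT) `‖x_i‖² − Σ_{j∈S}⟨x_i,χ_j⟩² ≤ C₂λ³⟨x_i,χ_{j₀}⟩²`, `C₁ + C₂ ≤ C`;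
  ★★★ `leakageFor_of_slowOutsideCoreFor : BasisPhys P → SlowOutsideCoreFor P → LeakageFor P` — NO statics, NO universality, NO width (CW) and NO
  in-level Gram (GR) input (those entered XV–XXI only through the reference reduction; per member they are absorbed in (SLOW));
* §4 `FirstMomentCoreFor P` — (SLOW) replaced by (BAND) `|μ_j − μ_{j₀}| ≤ D(λ/L)λ₀` on the slow set (where `x_i` has weight) and the FIRST-moment budget
  (NEAR₁) `Σ_{j∈S}|μ_j − μ_{j₀}|μ_j^{2L}⟨x_i,χ_j⟩² ≤ C_N(λ²/L)λ₀μ_{j₀}^{2L}⟨x_i,χ_{j₀}⟩²` (S-POS's NEAR currency), `D·C_N ≤ C₁`;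
  ★ `slowOutsideCoreFor_of_firstMomentCoreFor`, ★★★ `leakageFor_of_firstMomentCoreFor`;
* §5 `EuclideanLeakageFor P` + ★ `leakageFor_iff_euclideanFor` — the text in Euclidean currency ((E4): log-convexity defect of the normalised
  connected flowed-Polyakov autocorrelation at separation `2L+1` is `≤ C(λ³/L²)` relative), same constants (XII generic);
* §6 the cores are antitone in `P` too (`slowOutsideCoreFor_of_imp`, `firstMomentCoreFor_of_imp`).

So for the r6 crux map: «S-LEAK″ = `∀ k, LeakageFor (P k)` ⟸ `leakageFor_of_firstMomentCoreFor` ⟸ ■ `FirstMomentCoreFor (P k)` = (NEAR₁)+(BAND)+(OUT) per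
basis member» for ANY physical predicate family `P` (transplants included), and every r5 reading (Euclidean ∕ slab, kinematic gain of the dressing,
first-moment grade) transfers.  What does NOT transfer from r5 is only the reference reduction (XVII ∕ XXI-b), which was specific to exact eigen-ratios.

HONEST FRAMING: definitions + quantifier plumbing at fixed lattice on the conditional femto rung R2b1; `stub_liftLeakage` (r5) and `LeakageFor (TransplantBasis k)`
(r6) stay OPEN — their content is the renormalisation-group ∕ Born–Oppenheimer estimate (NEAR₁)+(OUT), not in print; nothing here bears on infinite volume,
the continuum limit or the Clay gap.
References: M. Lüscher, NPB 219 (1983) 233 [cite: Luscher1983, §3]; M. Lüscher, U. Wolff, NPB 339 (1990) 222 [cite: LuscherWolff1990, §2];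
T. Kato, J. Phys. Soc. Japan 4 (1949) 334 [cite: Kato1949, §1]; M. Reed, B. Simon IV (1978) Thm XIII.1 [cite: ReedSimonIV1978].
-/

set_option autoImplicit false

noncomputable section

open MeasureTheory Filter Topology Finset
open Literature.MathematicalPhysics.QuantumFieldTheory
open Literature.MathematicalPhysics.QuantumLattice
open scoped BigOperators

namespace Summit.QuantumFields.YangMills.Theorems.FemtoTransferGap.LiftLeak

open Summit.QuantumFields.YangMills.Theorems.FemtoTransferGap
open Summit.QuantumFields.YangMills.Theorems.FemtoTransferGap.PolyakovLift
open Summit.QuantumFields.YangMills.Theorems.FemtoTransferGap.VacDict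

variable {k : ℕ}

/-! ## §1 Monotonicity in the predicate; the r5 text at `P := liftBasisPred k` -/

/-- **`LeakageFor` is antitone in the basis predicate**: if every `P`-basis is a `P'`-basis then `LeakageFor P' → LeakageFor P` (same constants).
In particular pinning the cut-off radius of `TransplantBasis` (disprover's pre-vet V1) costs nothing downstream. [folklore] -/
theorem leakageFor_of_imp {P P' : ℝ → (Fin k → (GaugeConfig 3 1 SU2 → ℝ)) → Prop} (hPP' : ∀ Λ g, P Λ g → P' Λ g)
    (h : LeakageFor P') : LeakageFor P := by
  obtain ⟨C, lam0, hC, hlam0, hk⟩ := h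
  refine ⟨C, lam0, hC, hlam0, fun lam hlam hle => ?_⟩
  obtain ⟨L0, hL⟩ := hk lam hlam hle
  exact ⟨L0, fun L _ hL0 β hW φ hφ g hg => hL L hL0 β hW φ hφ g (hPP' _ _ hg)⟩

/-- At the r5 predicate `liftBasisPred k` (`∃ ω, LiftBasis (2/Λ³) k ω g`), `LeakageFor` is the level-`k` r5 text of S-LEAK (same constants;
`liftCoupling β L = 2/λ(β,L)³` by `rfl`). [cite: Luscher1983, §3] -/
theorem leakageFor_liftBasisPred_iff (k : ℕ) :
    LeakageFor (liftBasisPred k) ↔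
      ∃ C lam0 : ℝ, 0 ≤ C ∧ 0 < lam0 ∧ ∀ lam : ℝ, 0 < lam → lam ≤ lam0 → ∃ L0 : ℕ,
        ∀ (L : ℕ) [NeZero L], L0 ≤ L → ∀ β : ℝ, InFemtoWindow lam β L →
          ∀ φ : GaugeConfig 3 L SU2 → ℝ, IsRawVacuum β φ →
            ∀ (ω : GaugeConfig 3 1 SU2 → ℝ) (g : Fin k → (GaugeConfig 3 1 SU2 → ℝ)), LiftBasis (liftCoupling β L) k ω g →
              LeakageClause k C β (dressedLiftFamily β φ g) := by
  unfold LeakageFor liftBasisPred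
  constructor
  · rintro ⟨C, lam0, hC, hl, h⟩
    refine ⟨C, lam0, hC, hl, fun lam hlam hle => ?_⟩
    obtain ⟨L0, hL⟩ := h lam hlam hle
    exact ⟨L0, fun L _ hL0 β hW φ hφ ω g hb => hL L hL0 β hW φ hφ g ⟨ω, hb⟩⟩
  · rintro ⟨C, lam0, hC, hl, h⟩
    refine ⟨C, lam0, hC, hl, fun lam hlam hle => ?_⟩
    obtain ⟨L0, hL⟩ := h lam hlam hle
    exact ⟨L0, fun L _ hL0 β hW φ hφ g hg => by obtain ⟨ω, hb⟩ := hg; exact hL L hL0 β hW φ hφ ω g hb⟩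

/-- ★ **`(∀ k, LeakageFor (liftBasisPred k))` ⟺ the registered r5 text of `Stmt.stub_liftLeakage` VERBATIM.** [cite: Luscher1983, §3] -/
theorem forall_leakageFor_liftBasisPred_iff :
    (∀ k : ℕ, LeakageFor (liftBasisPred k)) ↔
      ∀ k : ℕ, ∃ C lam0 : ℝ, 0 ≤ C ∧ 0 < lam0 ∧ ∀ lam : ℝ, 0 < lam → lam ≤ lam0 → ∃ L0 : ℕ,
        ∀ (L : ℕ) [NeZero L], L0 ≤ L → ∀ β : ℝ, InFemtoWindow lam β L →
          ∀ φ : GaugeConfig 3 L SU2 → ℝ, IsRawVacuum β φ →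
            ∀ (ω : GaugeConfig 3 1 SU2 → ℝ) (g : Fin k → (GaugeConfig 3 1 SU2 → ℝ)), LiftBasis (liftCoupling β L) k ω g →
              LeakageClause k C β (dressedLiftFamily β φ g) :=
  forall_congr' fun k => leakageFor_liftBasisPred_iff k

/-- The same for STATICS: at `liftBasisPred k`, `StaticsFor` is the level-`k` r5 text of S-STAT (same constants). [cite: Luscher1983, §3] -/
theorem staticsFor_liftBasisPred_iff (k : ℕ) :
    StaticsFor (liftBasisPred k) ↔
      ∃ C lam0 : ℝ, 0 ≤ C ∧ 0 < lam0 ∧ ∀ lam : ℝ, 0 < lam → lam ≤ lam0 → ∃ L0 : ℕ,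
        ∀ (L : ℕ) [NeZero L], L0 ≤ L → ∀ β : ℝ, InFemtoWindow lam β L →
          ∀ φ : GaugeConfig 3 L SU2 → ℝ, IsRawVacuum β φ →
            ∀ (ω : GaugeConfig 3 1 SU2 → ℝ) (g : Fin k → (GaugeConfig 3 1 SU2 → ℝ)), LiftBasis (liftCoupling β L) k ω g →
              StaticClauses k C β (dressedLiftFamily β φ g) := by
  unfold StaticsFor liftBasisPred
  constructor
  · rintro ⟨C, lam0, hC, hl, h⟩
    refine ⟨C, lam0, hC, hl, fun lam hlam hle => ?_⟩
    obtain ⟨L0, hL⟩ := h lam hlam hle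
    exact ⟨L0, fun L _ hL0 β hW φ hφ ω g hb => hL L hL0 β hW φ hφ g ⟨ω, hb⟩⟩
  · rintro ⟨C, lam0, hC, hl, h⟩
    refine ⟨C, lam0, hC, hl, fun lam hlam hle => ?_⟩
    obtain ⟨L0, hL⟩ := h lam hlam hle
    exact ⟨L0, fun L _ hL0 β hW φ hφ g hg => by obtain ⟨ω, hb⟩ := hg; exact hL L hL0 β hW φ hφ ω g hb⟩

/-! ## §2 `LeakageFor P` from a per-member dressed residual law -/

/-- **`LeakageFor P` from a per-member RESIDUAL LAW at the Perron–Frobenius vacuum package**: eventually in the window, at `(Ω, θ, c)` (`IsVacuum`,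
`Ω ≥ c > 0`), for every `P`-basis `g` and every channel `i` an approximate eigenvalue `a` with
`‖K_β u_i − a·u_i‖² ≤ C(λ³/L²)λ₀²‖u_i‖²`, `u_i = dressedLiftVec β Ω g_i` (members physical).  The clause at an arbitrary raw vacuum `φ = ±Ω` follows
by `leakageClause_iterate_iff`. [cite: Kato1949, §1] [cite: Luscher1983, §3] -/
theorem leakageFor_of_residualLaw {P : ℝ → (Fin k → (GaugeConfig 3 1 SU2 → ℝ)) → Prop} (hP : BasisPhys P)
    (h : ∃ C lam0 : ℝ, 0 ≤ C ∧ 0 < lam0 ∧ ∀ lam : ℝ, 0 < lam → lam ≤ lam0 → ∃ L0 : ℕ,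
      ∀ (L : ℕ) [NeZero L], L0 ≤ L → ∀ β : ℝ, InFemtoWindow lam β L →
        ∀ (Ω : physSubmodule L) (θ c : ℝ), IsVacuum β Ω θ → 0 < c → (∀ U, c ≤ (Ω : GaugeConfig 3 L SU2 → ℝ) U) →
          ∀ g : Fin k → (GaugeConfig 3 1 SU2 → ℝ), P (luscherLambda β L) g →
            ∀ i : Fin k, ∃ a : ℝ,
              l2 (transferApply β (dressedLiftVec β (Ω : GaugeConfig 3 L SU2 → ℝ) (g i)) - a • dressedLiftVec β (Ω : GaugeConfig 3 L SU2 → ℝ) (g i))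
                  (transferApply β (dressedLiftVec β (Ω : GaugeConfig 3 L SU2 → ℝ) (g i)) - a • dressedLiftVec β (Ω : GaugeConfig 3 L SU2 → ℝ) (g i)) ≤
                C * (luscherLambda β L ^ 3 / (L : ℝ) ^ 2) * levelValue su2Rep L β 0 ^ 2 *
                  l2 (dressedLiftVec β (Ω : GaugeConfig 3 L SU2 → ℝ) (g i)) (dressedLiftVec β (Ω : GaugeConfig 3 L SU2 → ℝ) (g i))) :
    LeakageFor P := by
  obtain ⟨C, lam0, hC, hlam0, hk⟩ := h
  refine ⟨C, lam0, hC, hlam0, fun lam hlam hle => ?_⟩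
  obtain ⟨L0, hL⟩ := hk lam hlam hle
  refine ⟨L0, fun L _ hL0 β hW φ hφ g hg => ?_⟩
  obtain ⟨Ω, θ, c, hV, hc, hcle⟩ := exists_isVacuum (L := L) β
  have hΩclause : LeakageClause k C β (dressedLiftFamily β (Ω : GaugeConfig 3 L SU2 → ℝ) g) :=
    leakageClause_dressed_of_residual C β hV.raw.1 (hP _ _ hg) (hL L hL0 β hW Ω θ c hV hc hcle g hg)
  exact (leakageClause_iterate_iff hV hφ (dressSteps L) C g).2 hΩclause

/-! ## §3 The located core PER BASIS MEMBER: `SlowOutsideCoreFor P` -/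

/-- **`SlowOutsideCoreFor P`** — the located renormalisation-group core of `LeakageFor P`, asked per `P`-basis member: constants `C ≥ 0`, `lam0 > 0`;
eventually in the femto window, at the Perron–Frobenius package `(Ω, θ, c)`, for every `P`-basis `g` (read at `Λ = λ(β,L)`) and every channel `i`:
ONE exact physical `l2`-orthonormal fine eigenfamily `χ_0 … χ_{M−1}` of `K_β` (levels `μ_j`, dominating at `Λ ≥ 0`), an own index `j₀`
(`Λ ≤ μ_{j₀} ≤ λ₀`, kinematic gap `(L+1)²Λ^{2L} ≤ μ_{j₀}^{2L}` — free, `exists_eigenfamily_below`), a slow set `S` (`μ_j ≤ μ_{j₀}` off `S`), constants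
`C₁, C₂ ≥ 0` with `C₁ + C₂ ≤ C`, and on the UNDRESSED insertion state `x_i = liftVec β Ω g_i`:
(SLOW) `Σ_{j∈S}(μ_j − μ_{j₀})²μ_j^{2L}⟨x_i,χ_j⟩² ≤ C₁(λ³/L²)λ₀²·μ_{j₀}^{2L}⟨x_i,χ_{j₀}⟩²` and (OUT) `‖x_i‖² − Σ_{j∈S}⟨x_i,χ_j⟩² ≤ C₂λ³·⟨x_i,χ_{j₀}⟩²`.
[cite: Luscher1983, §3] [cite: LuscherWolff1990, §2] -/
def SlowOutsideCoreFor (P : ℝ → (Fin k → (GaugeConfig 3 1 SU2 → ℝ)) → Prop) : Prop :=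
  ∃ C lam0 : ℝ, 0 ≤ C ∧ 0 < lam0 ∧ ∀ lam : ℝ, 0 < lam → lam ≤ lam0 → ∃ L0 : ℕ,
    ∀ (L : ℕ) [NeZero L], L0 ≤ L → ∀ β : ℝ, InFemtoWindow lam β L →
      ∀ (Ω : physSubmodule L) (θ c : ℝ), IsVacuum β Ω θ → 0 < c → (∀ U, c ≤ (Ω : GaugeConfig 3 L SU2 → ℝ) U) →
        ∀ g : Fin k → (GaugeConfig 3 1 SU2 → ℝ), P (luscherLambda β L) g →
          ∀ i : Fin k, ∃ (M : ℕ) (χ : Fin M → (GaugeConfig 3 L SU2 → ℝ)) (μ : Fin M → ℝ) (Λ : ℝ) (j₀ : Fin M) (S : Finset (Fin M))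
            (C₁ C₂ : ℝ),
            (∀ j, IsPhys (χ j)) ∧ (∀ j j', l2 (χ j) (χ j') = if j = j' then 1 else 0) ∧
            (∀ j, transferApply β (χ j) = μ j • χ j) ∧ 0 ≤ Λ ∧ Λ ≤ μ j₀ ∧ μ j₀ ≤ levelValue su2Rep L β 0 ∧
            (∀ ξ : GaugeConfig 3 L SU2 → ℝ, IsPhys ξ → (∀ j, l2 ξ (χ j) = 0) → l2 ξ (transferApply β ξ) ≤ Λ * l2 ξ ξ) ∧
            (∀ j, j ∉ S → μ j ≤ μ j₀) ∧ ((dressSteps L : ℝ) + 1) ^ 2 * Λ ^ (2 * dressSteps L) ≤ μ j₀ ^ (2 * dressSteps L) ∧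
            0 ≤ C₁ ∧ 0 ≤ C₂ ∧ C₁ + C₂ ≤ C ∧
            ∑ j ∈ S, (μ j - μ j₀) ^ 2 * μ j ^ (2 * dressSteps L) * l2 (liftVec β (Ω : GaugeConfig 3 L SU2 → ℝ) (g i)) (χ j) ^ 2 ≤
              C₁ * (luscherLambda β L ^ 3 / (L : ℝ) ^ 2) * levelValue su2Rep L β 0 ^ 2 *
                (μ j₀ ^ (2 * dressSteps L) * l2 (liftVec β (Ω : GaugeConfig 3 L SU2 → ℝ) (g i)) (χ j₀) ^ 2) ∧
            l2 (liftVec β (Ω : GaugeConfig 3 L SU2 → ℝ) (g i)) (liftVec β (Ω : GaugeConfig 3 L SU2 → ℝ) (g i)) -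
                ∑ j ∈ S, l2 (liftVec β (Ω : GaugeConfig 3 L SU2 → ℝ) (g i)) (χ j) ^ 2 ≤
              C₂ * luscherLambda β L ^ 3 * l2 (liftVec β (Ω : GaugeConfig 3 L SU2 → ℝ) (g i)) (χ j₀) ^ 2

/-- ★★★ **`SlowOutsideCoreFor P → LeakageFor P`** for any predicate with physical members: per lattice point XIV `leakageClause_dressed_of_slow_outside`
at the PF vacuum, then `leakageClause_iterate_iff` to every raw vacuum.  No statics, universality, width or Gram input. [cite: Luscher1983, §3]
[cite: LuscherWolff1990, §2] [cite: Kato1949, §1] -/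
theorem leakageFor_of_slowOutsideCoreFor {P : ℝ → (Fin k → (GaugeConfig 3 1 SU2 → ℝ)) → Prop} (hP : BasisPhys P)
    (h : SlowOutsideCoreFor P) : LeakageFor P := by
  obtain ⟨C, lam0, hC, hlam0, hk⟩ := h
  refine ⟨C, lam0, hC, hlam0, fun lam hlam hle => ?_⟩
  obtain ⟨L0, hL⟩ := hk lam hlam hle
  refine ⟨L0, fun L _ hL0 β hW φ hφ g hg => ?_⟩
  obtain ⟨Ω, θ, c, hV, hc, hcle⟩ := exists_isVacuum (L := L) β
  have hβ : 0 ≤ β := zero_le_one.trans hW.1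
  have hΩclause : LeakageClause k C β (dressedLiftFamily β (Ω : GaugeConfig 3 L SU2 → ℝ) g) :=
    leakageClause_dressed_of_slow_outside hβ hV.raw.1 (hP _ _ hg) (hL L hL0 β hW Ω θ c hV hc hcle g hg)
  exact (leakageClause_iterate_iff hV hφ (dressSteps L) C g).2 hΩclause

/-! ## §4 The first-moment core PER BASIS MEMBER: `FirstMomentCoreFor P` -/

/-- **`FirstMomentCoreFor P`** — `SlowOutsideCoreFor P` with the second-moment clause (SLOW) replaced by the band width (BAND)
`|μ_j − μ_{j₀}|·⟨x_i,χ_j⟩² ≤ D(λ/L)λ₀·⟨x_i,χ_j⟩²` on the slow set and the FIRST-moment admixture budget (NEAR₁)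
`Σ_{j∈S}|μ_j − μ_{j₀}|μ_j^{2L}⟨x_i,χ_j⟩² ≤ C_N(λ²/L)λ₀·μ_{j₀}^{2L}⟨x_i,χ_{j₀}⟩²` (`D, C_N ≥ 0`, `D·C_N ≤ C₁`). [cite: Luscher1983, §3] [cite: LuscherWolff1990, §2] -/
def FirstMomentCoreFor (P : ℝ → (Fin k → (GaugeConfig 3 1 SU2 → ℝ)) → Prop) : Prop :=
  ∃ C lam0 : ℝ, 0 ≤ C ∧ 0 < lam0 ∧ ∀ lam : ℝ, 0 < lam → lam ≤ lam0 → ∃ L0 : ℕ,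
    ∀ (L : ℕ) [NeZero L], L0 ≤ L → ∀ β : ℝ, InFemtoWindow lam β L →
      ∀ (Ω : physSubmodule L) (θ c : ℝ), IsVacuum β Ω θ → 0 < c → (∀ U, c ≤ (Ω : GaugeConfig 3 L SU2 → ℝ) U) →
        ∀ g : Fin k → (GaugeConfig 3 1 SU2 → ℝ), P (luscherLambda β L) g →
          ∀ i : Fin k, ∃ (M : ℕ) (χ : Fin M → (GaugeConfig 3 L SU2 → ℝ)) (μ : Fin M → ℝ) (Λ : ℝ) (j₀ : Fin M) (S : Finset (Fin M))
            (C₁ C₂ D C_N : ℝ),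
            (∀ j, IsPhys (χ j)) ∧ (∀ j j', l2 (χ j) (χ j') = if j = j' then 1 else 0) ∧
            (∀ j, transferApply β (χ j) = μ j • χ j) ∧ 0 ≤ Λ ∧ Λ ≤ μ j₀ ∧ μ j₀ ≤ levelValue su2Rep L β 0 ∧
            (∀ ξ : GaugeConfig 3 L SU2 → ℝ, IsPhys ξ → (∀ j, l2 ξ (χ j) = 0) → l2 ξ (transferApply β ξ) ≤ Λ * l2 ξ ξ) ∧
            (∀ j, j ∉ S → μ j ≤ μ j₀) ∧ ((dressSteps L : ℝ) + 1) ^ 2 * Λ ^ (2 * dressSteps L) ≤ μ j₀ ^ (2 * dressSteps L) ∧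
            0 ≤ C₁ ∧ 0 ≤ C₂ ∧ C₁ + C₂ ≤ C ∧ 0 ≤ D ∧ 0 ≤ C_N ∧ D * C_N ≤ C₁ ∧
            (∀ j ∈ S, |μ j - μ j₀| * l2 (liftVec β (Ω : GaugeConfig 3 L SU2 → ℝ) (g i)) (χ j) ^ 2 ≤
              D * (luscherLambda β L / L) * levelValue su2Rep L β 0 * l2 (liftVec β (Ω : GaugeConfig 3 L SU2 → ℝ) (g i)) (χ j) ^ 2) ∧
            ∑ j ∈ S, |μ j - μ j₀| * μ j ^ (2 * dressSteps L) * l2 (liftVec β (Ω : GaugeConfig 3 L SU2 → ℝ) (g i)) (χ j) ^ 2 ≤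
              C_N * (luscherLambda β L ^ 2 / L) * levelValue su2Rep L β 0 *
                (μ j₀ ^ (2 * dressSteps L) * l2 (liftVec β (Ω : GaugeConfig 3 L SU2 → ℝ) (g i)) (χ j₀) ^ 2) ∧
            l2 (liftVec β (Ω : GaugeConfig 3 L SU2 → ℝ) (g i)) (liftVec β (Ω : GaugeConfig 3 L SU2 → ℝ) (g i)) -
                ∑ j ∈ S, l2 (liftVec β (Ω : GaugeConfig 3 L SU2 → ℝ) (g i)) (χ j) ^ 2 ≤
              C₂ * luscherLambda β L ^ 3 * l2 (liftVec β (Ω : GaugeConfig 3 L SU2 → ℝ) (g i)) (χ j₀) ^ 2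

/-- ★ **`FirstMomentCoreFor P → SlowOutsideCoreFor P`**: (BAND) × (NEAR₁) ⇒ (SLOW) with `C₁ ≥ D·C_N` (`slow_of_band_firstMoment_dressed`;
`D(λ/L)λ₀ · C_N(λ²/L)λ₀ = D·C_N·(λ³/L²)λ₀²`). [cite: Luscher1983, §3] [cite: Kato1949, §1] -/
theorem slowOutsideCoreFor_of_firstMomentCoreFor {P : ℝ → (Fin k → (GaugeConfig 3 1 SU2 → ℝ)) → Prop}
    (h : FirstMomentCoreFor P) : SlowOutsideCoreFor P := by
  obtain ⟨C, lam0, hC, hlam0, hk⟩ := h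
  refine ⟨C, lam0, hC, hlam0, fun lam hlam hle => ?_⟩
  obtain ⟨L0, hL⟩ := hk lam hlam hle
  refine ⟨L0, fun L _ hL0 β hW Ω θ c hV hc hcle g hg i => ?_⟩
  obtain ⟨M, χ, μ, Λ, j₀, S, C₁, C₂, D, C_N, hχ, hon, heig, hΛ, hΛμ, hμtop, hdom, hS, hgap, hC₁, hC₂, hCC, hD, hCN, hDC,
    hband, hnear, hout⟩ := hL L hL0 β hW Ω θ c hV hc hcle g hg i
  refine ⟨M, χ, μ, Λ, j₀, S, C₁, C₂, hχ, hon, heig, hΛ, hΛμ, hμtop, hdom, hS, hgap, hC₁, hC₂, hCC, ?_, hout⟩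
  have hlam0' : 0 ≤ luscherLambda β L := (luscherLambda_pos_of_window hlam hW).le
  have hLpos : (0 : ℝ) < L := Nat.cast_pos.mpr (NeZero.pos L)
  have hl0 : 0 ≤ levelValue su2Rep L β 0 := (levelValue_pos_of_window hW 0).le
  have hW0 : 0 ≤ D * (luscherLambda β L / L) * levelValue su2Rep L β 0 := mul_nonneg (mul_nonneg hD (div_nonneg hlam0' hLpos.le)) hl0
  set x := liftVec β (Ω : GaugeConfig 3 L SU2 → ℝ) (g i) with hx
  have hslow := slow_of_band_firstMoment_dressed S μ (fun j => l2 x (χ j)) (μ j₀) _ _ (dressSteps L) hW0 hband hnear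
  have hX : 0 ≤ (luscherLambda β L ^ 3 / (L : ℝ) ^ 2) * levelValue su2Rep L β 0 ^ 2 * (μ j₀ ^ (2 * dressSteps L) * l2 x (χ j₀) ^ 2) :=
    mul_nonneg (mul_nonneg (div_nonneg (pow_nonneg hlam0' 3) (sq_nonneg _)) (sq_nonneg _))
      (mul_nonneg (by rw [pow_mul']; exact sq_nonneg _) (sq_nonneg _))
  calc ∑ j ∈ S, (μ j - μ j₀) ^ 2 * μ j ^ (2 * dressSteps L) * l2 x (χ j) ^ 2
      ≤ D * (luscherLambda β L / L) * levelValue su2Rep L β 0 *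
          (C_N * (luscherLambda β L ^ 2 / L) * levelValue su2Rep L β 0 * (μ j₀ ^ (2 * dressSteps L) * l2 x (χ j₀) ^ 2)) := hslow
    _ = (D * C_N) * ((luscherLambda β L ^ 3 / (L : ℝ) ^ 2) * levelValue su2Rep L β 0 ^ 2 * (μ j₀ ^ (2 * dressSteps L) * l2 x (χ j₀) ^ 2)) := by
        field_simp
    _ ≤ C₁ * ((luscherLambda β L ^ 3 / (L : ℝ) ^ 2) * levelValue su2Rep L β 0 ^ 2 * (μ j₀ ^ (2 * dressSteps L) * l2 x (χ j₀) ^ 2)) :=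
        mul_le_mul_of_nonneg_right hDC hX
    _ = C₁ * (luscherLambda β L ^ 3 / (L : ℝ) ^ 2) * levelValue su2Rep L β 0 ^ 2 * (μ j₀ ^ (2 * dressSteps L) * l2 x (χ j₀) ^ 2) := by
        ring

/-- ★★★ **`FirstMomentCoreFor P → LeakageFor P`** (members physical): S-LEAK for the predicate `P` is of FIRST-MOMENT grade — the time-dressing `K_β^[L]`
supplies every `L⁻²`. [cite: Luscher1983, §3] [cite: LuscherWolff1990, §2] [cite: Kato1949, §1] -/
theorem leakageFor_of_firstMomentCoreFor {P : ℝ → (Fin k → (GaugeConfig 3 1 SU2 → ℝ)) → Prop} (hP : BasisPhys P)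
    (h : FirstMomentCoreFor P) : LeakageFor P :=
  leakageFor_of_slowOutsideCoreFor hP (slowOutsideCoreFor_of_firstMomentCoreFor h)

/-! ## §5 Euclidean currency -/

/-- **`EuclideanLeakageFor P`** — `LeakageFor P` in Euclidean currency: deep in the femto window, for every raw vacuum `φ` and every `P`-basis `g`,
with `c = corr β φ (flowLiftAt 0 (flowTime β L) ∘ g)` and `m = dressSteps L`, for every channel
(E4) `c(2m+2)_{ii}·c(2m)_{ii} − c(2m+1)_{ii}² ≤ C(λ³/L²)·c(2m)_{ii}²`. [cite: LuscherWolff1990, §2] [cite: Luscher1983, §3] -/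
def EuclideanLeakageFor (P : ℝ → (Fin k → (GaugeConfig 3 1 SU2 → ℝ)) → Prop) : Prop :=
  ∃ C lam0 : ℝ, 0 ≤ C ∧ 0 < lam0 ∧ ∀ lam : ℝ, 0 < lam → lam ≤ lam0 → ∃ L0 : ℕ,
    ∀ (L : ℕ) [NeZero L], L0 ≤ L → ∀ β : ℝ, InFemtoWindow lam β L →
      ∀ φ : GaugeConfig 3 L SU2 → ℝ, IsRawVacuum β φ →
        ∀ g : Fin k → (GaugeConfig 3 1 SU2 → ℝ), P (luscherLambda β L) g →
          let c := corr β φ (fun i => flowLiftAt (L := L) 0 (flowTime β L) (g i))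
          let m := dressSteps L
          ∀ i : Fin k, c (2 * m + 2) i i * c (2 * m) i i - c (2 * m + 1) i i ^ 2 ≤ C * (luscherLambda β L ^ 3 / (L : ℝ) ^ 2) * c (2 * m) i i ^ 2

/-- ★ **`LeakageFor P ↔ EuclideanLeakageFor P`** (members physical; same `C`, `lam0`, `L0`), by XII `leakageClause_iff_euclidean` per lattice point.
[cite: LuscherWolff1990, §2] [cite: Kato1949, §1] -/
theorem leakageFor_iff_euclideanFor {P : ℝ → (Fin k → (GaugeConfig 3 1 SU2 → ℝ)) → Prop} (hP : BasisPhys P) :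
    LeakageFor P ↔ EuclideanLeakageFor P := by
  unfold LeakageFor EuclideanLeakageFor
  refine exists_congr fun C => exists_congr fun lam0 => and_congr_right fun _ => and_congr_right fun _ => ?_
  refine forall_congr' fun lam => forall_congr' fun hlam => forall_congr' fun _ => exists_congr fun L0 => ?_
  refine forall_congr' fun L => forall_congr' fun _ => forall_congr' fun _ => forall_congr' fun β => forall_congr' fun hW => ?_
  refine forall_congr' fun φ => forall_congr' fun hφ => forall_congr' fun g => forall_congr' fun hg => ?_
  have hβ : 0 < β := zero_lt_one.trans_le hW.1
  exact leakageClause_iff_euclidean (C := C) hβ hφ.1 (hP _ _ hg)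

/-! ## §6 The cores are antitone in the predicate -/

/-- `SlowOutsideCoreFor` is antitone in the basis predicate. [folklore] -/
theorem slowOutsideCoreFor_of_imp {P P' : ℝ → (Fin k → (GaugeConfig 3 1 SU2 → ℝ)) → Prop} (hPP' : ∀ Λ g, P Λ g → P' Λ g)
    (h : SlowOutsideCoreFor P') : SlowOutsideCoreFor P := by
  obtain ⟨C, lam0, hC, hlam0, hk⟩ := h
  refine ⟨C, lam0, hC, hlam0, fun lam hlam hle => ?_⟩
  obtain ⟨L0, hL⟩ := hk lam hlam hle
  exact ⟨L0, fun L _ hL0 β hW Ω θ c hV hc hcle g hg => hL L hL0 β hW Ω θ c hV hc hcle g (hPP' _ _ hg)⟩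

/-- `FirstMomentCoreFor` is antitone in the basis predicate. [folklore] -/
theorem firstMomentCoreFor_of_imp {P P' : ℝ → (Fin k → (GaugeConfig 3 1 SU2 → ℝ)) → Prop} (hPP' : ∀ Λ g, P Λ g → P' Λ g)
    (h : FirstMomentCoreFor P') : FirstMomentCoreFor P := by
  obtain ⟨C, lam0, hC, hlam0, hk⟩ := h
  refine ⟨C, lam0, hC, hlam0, fun lam hlam hle => ?_⟩
  obtain ⟨L0, hL⟩ := hk lam hlam hle
  exact ⟨L0, fun L _ hL0 β hW Ω θ c hV hc hcle g hg => hL L hL0 β hW Ω θ c hV hc hcle g (hPP' _ _ hg)⟩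

/-- `EuclideanLeakageFor` is antitone in the basis predicate. [folklore] -/
theorem euclideanLeakageFor_of_imp {P P' : ℝ → (Fin k → (GaugeConfig 3 1 SU2 → ℝ)) → Prop} (hPP' : ∀ Λ g, P Λ g → P' Λ g)
    (h : EuclideanLeakageFor P') : EuclideanLeakageFor P := by
  obtain ⟨C, lam0, hC, hlam0, hk⟩ := h
  refine ⟨C, lam0, hC, hlam0, fun lam hlam hle => ?_⟩
  obtain ⟨L0, hL⟩ := hk lam hlam hle
  exact ⟨L0, fun L _ hL0 β hW φ hφ g hg => hL L hL0 β hW φ hφ g (hPP' _ _ hg)⟩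

end Summit.QuantumFields.YangMills.Theorems.FemtoTransferGap.LiftLeak

end
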